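import Literature.NumberTheory.Automorphic.ParabolicBruhatCellSupport
import Literature.NumberTheory.Automorphic.SmoothInduction
import Literature.NumberTheory.Automorphic.CompactOpenAveraging
import Literature.NumberTheory.Automorphic.ShintaniWhittakerFormula
import HarnessLib

/-!
# Whittaker functionals of induced representations: the non-open Bruhat cells contribute nothing

Topic `NumberTheory/Automorphic`. Let `F` be a non-archimedean local field, `P = P_c ≤ GL_n(F)` a
standard parabolic subgroup of a monotone block labelling `c` with unipotent radical `N = N_c`,
`σ'` a representation of `P` trivial on `N` (e.g. inflated from the Levi), and
`E = Ind_P^G σ'` the smoothly induced representation (`Representation.SmoothInd`, the tree's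
`SmoothInduction`), restricted to `U = U_n` and twisted by the inverse of the generic character
`ψ_U` (`whittakerTwist`), so that its coinvariants are the `ψ`-twisted Jacquet module whose dual
is the space of Whittaker functionals. For a closed right-`U`-stable `Z ⊆ G` let
`vanishingOn Z ≤ E` be the functions vanishing on `Z`; the Bruhat cells `P P_σ U` of
`ParabolicBruhatCells*` give the `U`-stable filtration `vanishingOn (cellLE c σ) ≤ vanishingOn (cellLT c σ)`.

**Theorem** (`exists_sub_mem_span_of_ascent`). If the cell of `σ` is not the open one, i.e. the
block word has an ascent `c (σ⁻¹ i) < c (σ⁻¹ (i+1))`, and `ψ` is continuous and non-trivial,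
then every `f ∈ vanishingOn (cellLT c σ)` is congruent, modulo the span of the
`x - ψ_U(u)⁻¹ (u · x)` (`x ∈ vanishingOn (cellLT c σ)`, `u ∈ U`), to some
`f' ∈ vanishingOn (cellLE c σ)`. In other words the graded piece of `Ind_P^G σ'|_U` living on the
cell `P P_σ U` has **zero `ψ`-twisted coinvariants**: this is the vanishing half of Rodier's
heredity theorem / of the top-derivative case of the Leibniz rule of Bernstein–Zelevinsky
(1977, Thm. 5.2 with 4.5–4.7: in the filtration of `r_{U,θ} ∘ i_{P}` by the `U`-orbits on
`P \ G`, an orbit contributes only if `θ` is trivial on `U ∩ w⁻¹ N w`).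

## Proof

`f' = |R|⁻¹ ∑_{r ∈ R} ψ_U(r)⁻¹ (r · f)` is a finite twisted average over a transversal `R` of
`U_j / S`, with `U_j` a compact open subgroup of `U` containing the compact set `C` of
`exists_isCompact_support_of_eq_zero_on_cellLT` and the elementary unipotent
`r₀ = 1 + x₀ E_{i,i+1}` (`ψ x₀ ≠ 1`), and `S ≤ U_j` open, fixing `f` and inside `Ker ψ_U`. Then
`f - f' = |R|⁻¹ ∑ (f - ψ_U(r)⁻¹ r · f)` lies in the span, and `f'` vanishes on `P P_σ U`: on
`p P_σ u₀` its value is `σ'(p) S(u₀)`, `S(u₀) = ∑_r ψ_U(r)⁻¹ f (P_σ u₀ r)`; if `u₀ ∉ A' U_j`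
(`A' = U ∩ P_σ⁻¹ P P_σ`) every term vanishes by the support lemma; if `u₀ = a u₁` then
`S(u₀) = σ'(P_σ a P_σ⁻¹) ψ_U(u₁) S(1)` by re-indexing the transversal (`sum_mul_left` of
`CompactOpenAveraging`), and `S(1) = ψ(x₀)⁻¹ S(1)` because `f (P_σ r₀ y) = f (P_σ y)`
(`P_σ r₀ P_σ⁻¹ ∈ N` acts trivially) — so `S(1) = 0`.

Also in this file: the elementary unipotents `u_{ik}(x) = transvectionGL i k x` under conjugation by
permutation matrices (`permGL_mul_transvectionGL_mul_inv`), `u_{ab}(x) ∈ N_c` for `c a < c b`,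
`ψ_U(u_{i,i+1}(x)) = ψ x`; and the subspaces `vanishingOn`. Theorems only (plus the `def`s
`vanishingOn`, `SmoothInd.toFunₗ` with bodies); no named fact.

## References

* I. N. Bernstein, A. V. Zelevinsky, *Induced representations of reductive `p`-adic groups I*,
  Ann. Sci. ÉNS 10 (1977), Thm. 5.2 and its proof (§6), 4.5–4.7 (held, read).
  [BernsteinZelevinskyASENS1977]
* F. Rodier, *Whittaker models for admissible representations of reductive `p`-adic split
  groups*, Proc. Sympos. Pure Math. 26 (1973), 425–430, Thm. (heredity). [Rodier1973]
* D. Bump, *Automorphic Forms and Representations* (1997), §4.4 (the `N`-coinvariants, PDF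
  p. 462). [Bump1997]
-/

open scoped BigOperators
open Matrix

namespace Literature.NumberTheory.Automorphic

/-! ### Elementary unipotents, permutation conjugation, the unipotent radical -/

section RootMoves

variable {K : Type*} [Field K] {n : ℕ}

/-- The permutation matrix of the identity is `1`. [folklore] -/
@[simp] theorem permGL_one : (permGL (1 : Equiv.Perm (Fin n)) : GL (Fin n) K) = 1 := by
  refine Units.ext ?_
  rw [coe_permGL, Equiv.Perm.permMatrix, Equiv.Perm.one_def, Equiv.toPEquiv_refl,
    PEquiv.toMatrix_refl, Units.val_one]

/-- `(P_σ)⁻¹ = P_{σ⁻¹}`. [folklore] -/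
theorem permGL_inv (σ : Equiv.Perm (Fin n)) : ((permGL σ : GL (Fin n) K))⁻¹ = permGL σ⁻¹ := by
  refine inv_eq_of_mul_eq_one_right ?_
  rw [permGL_mul_permGL, inv_mul_cancel, permGL_one]

/-- **Conjugation by a permutation matrix reindexes**: `P_σ g P_σ⁻¹ = (g_{σ a, σ b})_{a,b}`.
[folklore] -/
theorem coe_permGL_mul_mul_inv (σ : Equiv.Perm (Fin n)) (g : GL (Fin n) K) :
    (((permGL σ * g * (permGL σ)⁻¹ : GL (Fin n) K)) : Matrix (Fin n) (Fin n) K) =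
      (g : Matrix (Fin n) (Fin n) K).submatrix σ σ := by
  rw [permGL_inv, Units.val_mul, Units.val_mul, coe_permGL, coe_permGL, Equiv.Perm.permMatrix,
    Equiv.Perm.permMatrix, PEquiv.toMatrix_toPEquiv_mul, PEquiv.mul_toMatrix_toPEquiv]
  ext a b
  simp [Equiv.Perm.inv_def]

/-- Conjugating by `P_ρ` carries `P_{c ∘ ρ⁻¹}` onto `P_c`: `P_ρ g P_ρ⁻¹ ∈ P_c ↔ g ∈ P_{c ∘ ρ⁻¹}`.
[folklore] -/
theorem permGL_mul_mul_inv_mem_standardParabolicGL_iff {α : Type*} [LinearOrder α] (c : Fin n → α)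
    (ρ : Equiv.Perm (Fin n)) (g : GL (Fin n) K) :
    permGL ρ * g * (permGL ρ)⁻¹ ∈ standardParabolicGL K c ↔
      g ∈ standardParabolicGL K (c ∘ ρ.symm) := by
  rw [mem_standardParabolicGL_iff, mem_standardParabolicGL_iff, coe_permGL_mul_mul_inv]
  constructor
  · intro h i j hij
    have := @h (ρ.symm i) (ρ.symm j) (by simpa using hij)
    simpa using this
  · intro h a b hab
    exact @h (ρ a) (ρ b) (by simpa using hab)

/-- Conjugating by `P_ρ` carries `N_{c ∘ ρ⁻¹}` onto `N_c`:
`P_ρ g P_ρ⁻¹ ∈ N_c ↔ g ∈ N_{c ∘ ρ⁻¹}`. [folklore] -/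
theorem permGL_mul_mul_inv_mem_unipotentRadicalGL_iff {α : Type*} [LinearOrder α] (c : Fin n → α)
    (ρ : Equiv.Perm (Fin n)) (g : GL (Fin n) K) :
    permGL ρ * g * (permGL ρ)⁻¹ ∈ unipotentRadicalGL K c ↔
      g ∈ unipotentRadicalGL K (c ∘ ρ.symm) := by
  rw [mem_unipotentRadicalGL_iff_apply, mem_unipotentRadicalGL_iff_apply, coe_permGL_mul_mul_inv]
  constructor
  · intro h i j hij
    have := h (ρ.symm i) (ρ.symm j) (by simpa using hij)
    simpa [Matrix.one_apply] using this
  · intro h a b hab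
    have := h (ρ a) (ρ b) (by simpa using hab)
    simpa [Matrix.one_apply] using this

/-- Conjugating an elementary unipotent by a permutation matrix:
`P_σ u_{ab}(x) P_σ⁻¹ = u_{σ⁻¹ a, σ⁻¹ b}(x)`. [folklore] -/
theorem permGL_mul_transvectionGL_mul_inv (σ : Equiv.Perm (Fin n)) {a b : Fin n} (hab : a ≠ b)
    (x : K) :
    permGL σ * transvectionGL a b hab x * (permGL σ)⁻¹ =
      transvectionGL (σ.symm a) (σ.symm b) (σ.symm.injective.ne hab) x := by
  refine Units.ext ?_
  rw [coe_permGL_mul_mul_inv, coe_transvectionGL, coe_transvectionGL]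
  ext i j
  simp only [Matrix.submatrix_apply, Matrix.transvection, Matrix.add_apply, Matrix.one_apply,
    Matrix.single_apply, σ.injective.eq_iff]
  congr 1
  simp only [Equiv.eq_symm_apply, eq_comm]

/-- An elementary unipotent strictly above the block diagonal lies in the unipotent radical:
`u_{ab}(x) ∈ N_c` if `c a < c b`. [folklore] -/
theorem transvectionGL_mem_unipotentRadicalGL {α : Type*} [LinearOrder α] (c : Fin n → α)
    {a b : Fin n} (hab : c a < c b) (x : K) :
    transvectionGL a b (fun h => by rw [h] at hab; exact lt_irrefl _ hab) x ∈ unipotentRadicalGL K c := by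
  rw [mem_unipotentRadicalGL_iff_apply]
  intro i j hij
  rw [coe_transvectionGL, Matrix.transvection, Matrix.add_apply, Matrix.single_apply, add_eq_left]
  rw [ite_eq_right_iff]
  rintro ⟨rfl, rfl⟩
  exact absurd hab (not_lt.2 hij)

/-- **An ascent moves a simple root group into the unipotent radical**: if
`c (σ⁻¹ i) < c (σ⁻¹ (i+1))` then `P_σ u_{i,i+1}(x) P_σ⁻¹ ∈ N_c`. [folklore] -/
theorem permGL_mul_transvectionGL_mul_inv_mem_unipotentRadicalGL {α : Type*} [LinearOrder α]
    (c : Fin n → α) (σ : Equiv.Perm (Fin n)) {i k : Fin n} (hik : i ≠ k)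
    (hasc : c (σ.symm i) < c (σ.symm k)) (x : K) :
    permGL σ * transvectionGL i k hik x * (permGL σ)⁻¹ ∈ unipotentRadicalGL K c := by
  rw [permGL_mul_transvectionGL_mul_inv]
  exact transvectionGL_mem_unipotentRadicalGL c hasc x

/-- The super-diagonal sum of `u_{i,i+1}(x)` is `x`. [folklore] -/
theorem superdiagSum_transvectionGL {i k : Fin n} (hik : (i : ℕ) + 1 = k) (x : K) :
    superdiagSum ⟨transvectionGL i k (fun h => by rw [h] at hik; omega) x,
      transvectionGL_mem_upperUnitriangular (Fin.lt_def.2 (by omega)) x⟩ = x := by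
  rw [superdiagSum_def]
  rw [Finset.sum_eq_single i]
  · rw [Finset.sum_eq_single k]
    · rw [if_pos hik]
      change ((transvectionGL i k _ x : GL (Fin n) K) : Matrix (Fin n) (Fin n) K) i k = x
      rw [transvectionGL_apply, if_neg (fun h : i = k => by rw [h] at hik; omega), if_pos ⟨rfl, rfl⟩,
        zero_add]
    · intro b _ hb
      rw [if_neg]
      intro h
      exact hb (Fin.ext (by omega))
    · intro h
      exact absurd (Finset.mem_univ k) h
  · intro a _ ha
    refine Finset.sum_eq_zero fun b _ => ?_
    split_ifs with hab
    · change ((transvectionGL i k _ x : GL (Fin n) K) : Matrix (Fin n) (Fin n) K) a b = 0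
      rw [transvectionGL_apply, if_neg (fun h : a = b => by rw [h] at hab; omega), zero_add, if_neg]
      rintro ⟨rfl, -⟩
      exact ha rfl
    · rfl
  · intro h
    exact absurd (Finset.mem_univ i) h

/-- `ψ_U(u_{i,i+1}(x)) = ψ x`. [folklore] -/
theorem whittakerChar_transvectionGL (ψ : AddChar K Circle) {i k : Fin n} (hik : (i : ℕ) + 1 = k)
    (x : K) :
    ((whittakerChar (n := n) ψ ⟨transvectionGL i k (fun h => by rw [h] at hik; omega) x,
      transvectionGL_mem_upperUnitriangular (Fin.lt_def.2 (by omega)) x⟩ : ℂˣ) : ℂ) = ψ x := by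
  rw [coe_whittakerChar, whittakerCharFun_apply, superdiagSum_transvectionGL hik]

end RootMoves

/-! ### Functions vanishing on a subset, inside an induced representation -/

section Vanishing

variable {k G W : Type*} [CommRing k] [Group G] [TopologicalSpace G] [SeparatelyContinuousMul G]
  [AddCommGroup W] [Module k W] (H : Subgroup G) (σ : Representation k H W)

/-- Evaluation of the underlying function, as a linear map `Ind_H^G σ →ₗ (G → W)`. [folklore] -/
def Representation.SmoothInd.toFunₗ : Representation.SmoothInd H σ →ₗ[k] (G → W) where
  toFun f := f.toFun
  map_add' := Representation.SmoothInd.toFun_add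
  map_smul' := Representation.SmoothInd.toFun_smul

/-- `toFunₗ f = f.toFun`. [folklore] -/
@[simp] lemma Representation.SmoothInd.toFunₗ_apply (f : Representation.SmoothInd H σ) :
    Representation.SmoothInd.toFunₗ H σ f = f.toFun := rfl

/-- The underlying function of a finite sum is the sum of the underlying functions. [folklore] -/
lemma Representation.SmoothInd.toFun_sum {ι : Type*} (s : Finset ι)
    (f : ι → Representation.SmoothInd H σ) (g : G) :
    (∑ i ∈ s, f i).toFun g = ∑ i ∈ s, (f i).toFun g := by
  have h := map_sum (Representation.SmoothInd.toFunₗ H σ) f s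
  simp only [Representation.SmoothInd.toFunₗ_apply] at h
  rw [h, Finset.sum_apply]

/-- The subspace of `Ind_H^G σ` of functions **vanishing on** a subset `Z ⊆ G`. [folklore] -/
def vanishingOn (Z : Set G) : Submodule k (Representation.SmoothInd H σ) where
  carrier := {f | ∀ g ∈ Z, f.toFun g = 0}
  zero_mem' g _ := rfl
  add_mem' hf hf' g hg := by
    rw [Representation.SmoothInd.toFun_add, Pi.add_apply, hf g hg, hf' g hg, add_zero]
  smul_mem' c f hf g hg := by
    rw [Representation.SmoothInd.toFun_smul, Pi.smul_apply, hf g hg, smul_zero]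

variable {H σ}

/-- Membership in `vanishingOn`. [folklore] -/
lemma mem_vanishingOn_iff {Z : Set G} (f : Representation.SmoothInd H σ) :
    f ∈ vanishingOn H σ Z ↔ ∀ g ∈ Z, f.toFun g = 0 := Iff.rfl

/-- `vanishingOn` is antitone in the subset. [folklore] -/
lemma vanishingOn_mono {Z Z' : Set G} (h : Z ⊆ Z') : vanishingOn H σ Z' ≤ vanishingOn H σ Z :=
  fun _ hf g hg => hf g (h hg)

/-- `vanishingOn (Z ∪ Z') = vanishingOn Z ⊓ vanishingOn Z'`. [folklore] -/
lemma vanishingOn_union {Z Z' : Set G} :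
    vanishingOn H σ (Z ∪ Z') = vanishingOn H σ Z ⊓ vanishingOn H σ Z' := by
  ext f
  simp only [mem_vanishingOn_iff, Set.mem_union, Submodule.mem_inf]
  exact ⟨fun h => ⟨fun g hg => h g (Or.inl hg), fun g hg => h g (Or.inr hg)⟩,
    fun h g hg => hg.elim (h.1 g) (h.2 g)⟩

/-- `vanishingOn ∅ = ⊤`. [folklore] -/
@[simp] lemma vanishingOn_empty : vanishingOn H σ (∅ : Set G) = ⊤ :=
  eq_top_iff.2 fun _ _ _ hg => absurd hg (Set.notMem_empty _)

/-- `vanishingOn univ = ⊥`. [folklore] -/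
@[simp] lemma vanishingOn_univ : vanishingOn H σ (Set.univ : Set G) = ⊥ :=
  eq_bot_iff.2 fun _ hf => (Submodule.mem_bot k).2
    (Representation.SmoothInd.ext (funext fun g => hf g (Set.mem_univ g)))

/-- Right translation by `x` maps `vanishingOn Z` into `vanishingOn Z'` whenever `Z' x ⊆ Z`.
[folklore] -/
lemma smoothIndRep_apply_mem_vanishingOn {Z Z' : Set G} {x : G} (hZ : ∀ g ∈ Z', g * x ∈ Z)
    {f : Representation.SmoothInd H σ} (hf : f ∈ vanishingOn H σ Z) :
    Representation.smoothIndRep H σ x f ∈ vanishingOn H σ Z' := fun g hg => by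
  rw [Representation.toFun_smoothIndRep_apply]
  exact hf _ (hZ g hg)

/-- An element of `Ind_H^G σ` is **locally constant** as a function on `G` (it is right
invariant under its open stabiliser). [folklore] -/
theorem Representation.SmoothInd.isLocallyConstant_toFun [ContinuousMul G]
    (f : Representation.SmoothInd H σ) : IsLocallyConstant f.toFun := by
  have hopen : IsOpen ((Representation.smoothIndRep H σ).stabilizerSubgroup f : Set G) :=
    Representation.isSmooth_smoothInd H σ f
  refine (IsLocallyConstant.iff_exists_open _).2 fun g => ?_
  refine ⟨(fun y => g * y) '' ((Representation.smoothIndRep H σ).stabilizerSubgroup f : Set G),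
    (isOpenMap_mul_left g) _ hopen, ⟨1, Subgroup.one_mem _, mul_one g⟩, ?_⟩
  rintro _ ⟨y, hy, rfl⟩
  have hy' : Representation.smoothIndRep H σ y f = f :=
    (Representation.mem_stabilizerSubgroup _ _ _).1 hy
  have := congrArg (fun F : Representation.SmoothInd H σ => F.toFun g) hy'
  simpa only [Representation.toFun_smoothIndRep_apply] using this

/-- The non-vanishing set of an element of `Ind_H^G σ` is closed (indeed clopen). [folklore] -/
theorem Representation.SmoothInd.isClosed_setOf_toFun_ne_zero [ContinuousMul G]
    (f : Representation.SmoothInd H σ) : IsClosed {g | f.toFun g ≠ 0} := by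
  have : {g | f.toFun g ≠ 0} = {g | f.toFun g = 0}ᶜ := by
    ext g
    simp
  rw [this, isClosed_compl_iff]
  exact (Representation.SmoothInd.isLocallyConstant_toFun f).isOpen_fiber 0

end Vanishing

/-! ### The vanishing theorem on a cell with an ascent -/

section MainVanishing

variable {F : Type*} [Field F] [ValuativeRel F] [TopologicalSpace F] [IsNonarchimedeanLocalField F]
  {n : ℕ} {α : Type*} [LinearOrder α] [Fintype α] (c : Fin n → α)
  {W : Type*} [AddCommGroup W] [Module ℂ W]
  (σ' : Representation ℂ ↥(standardParabolicGL F c) W) (ψ : AddChar F Circle)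

omit [Fintype α] in
/-- The value of a twisted right translate: `(ψ_U(u)⁻¹ u · f)(g) = ψ_U(u)⁻¹ f(g u)`. [folklore] -/
lemma toFun_whittakerTwist_smoothIndRep (u : ↥(upperUnitriangular (Fin n) F))
    (f : Representation.SmoothInd (standardParabolicGL F c) σ') (g : GL (Fin n) F) :
    (whittakerTwist (Representation.smoothIndRep (standardParabolicGL F c) σ') ψ u f).toFun g =
      (whittakerCharFun ψ u)⁻¹ • f.toFun (g * u) := by
  rw [whittakerTwist_apply, Representation.SmoothInd.toFun_smul, Pi.smul_apply,
    Representation.toFun_smoothIndRep_apply]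

omit [Fintype α] in
/-- The twisted action preserves `vanishingOn Z` for a right-`U_n`-stable `Z`. [folklore] -/
lemma whittakerTwist_apply_mem_vanishingOn {Z : Set (GL (Fin n) F)}
    (hZ : ∀ g ∈ Z, ∀ u : ↥(upperUnitriangular (Fin n) F), g * u ∈ Z)
    (u : ↥(upperUnitriangular (Fin n) F))
    {f : Representation.SmoothInd (standardParabolicGL F c) σ'}
    (hf : f ∈ vanishingOn (standardParabolicGL F c) σ' Z) :
    whittakerTwist (Representation.smoothIndRep (standardParabolicGL F c) σ') ψ u f ∈
      vanishingOn (standardParabolicGL F c) σ' Z := by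
  rw [whittakerTwist_apply]
  exact Submodule.smul_mem _ _ (smoothIndRep_apply_mem_vanishingOn (fun g hg => hZ g hg u) hf)

omit [ValuativeRel F] [TopologicalSpace F] [IsNonarchimedeanLocalField F] in
/-- `cellsBelow c D` (hence `cellLT`, `cellLE`) is right-`U_n`-stable. [folklore] -/
lemma mul_mem_cellsBelow {D : Set (ℕ ×ₗ Lex (Fin n → α))} {g : GL (Fin n) F}
    (hg : g ∈ cellsBelow (K := F) c D) (u : ↥(upperUnitriangular (Fin n) F)) :
    g * u ∈ cellsBelow (K := F) c D := by
  have := mul_mul_mem_cellsBelow (K := F) c hg (Subgroup.one_mem _) u.2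
  rwa [one_mul] at this

/-- **The cell with an ascent has no twisted coinvariants** (vanishing half of the heredity
theorem; Bernstein–Zelevinsky 1977, Thm. 5.2: a `U`-orbit on `P \ G` on which `θ` is non-trivial
on `U ∩ w⁻¹ N w` contributes nothing to `r_{U,θ} ∘ i_P`). Let `c` be monotone, `σ'` a
representation of `P_c` trivial on the unipotent radical `N_c`, `ψ` continuous and non-trivial,
and suppose the block word of `σ` has an ascent at `i`. Then for every `f ∈ Ind_{P_c}^G σ'`
vanishing on `cellLT c σ` there is `f'` vanishing on `cellLE c σ` with `f - f'` in the span of the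
vectors `x - ψ_U(u)⁻¹ (u · x)`, `x ∈ vanishingOn (cellLT c σ)`, `u ∈ U_n`.
[cite: BernsteinZelevinskyASENS1977, Thm. 5.2] -/
theorem exists_sub_mem_span_of_ascent (hc : Monotone c) {σ : Equiv.Perm (Fin n)} {i : Fin n}
    (hi : (i : ℕ) + 1 < n) (hasc : c (σ.symm i) < c (σ.symm ⟨(i : ℕ) + 1, hi⟩))
    (hN : ∀ p : ↥(standardParabolicGL F c), (p : GL (Fin n) F) ∈ unipotentRadicalGL F c → σ' p = 1)
    (hψ : ψ.IsContinuousNontrivial)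
    (f : Representation.SmoothInd (standardParabolicGL F c) σ')
    (hf : f ∈ vanishingOn (standardParabolicGL F c) σ' (cellLT (K := F) c σ)) :
    ∃ f' ∈ vanishingOn (standardParabolicGL F c) σ' (cellLE (K := F) c σ),
      f - f' ∈ Submodule.span ℂ {y | ∃ (u : ↥(upperUnitriangular (Fin n) F))
        (x : Representation.SmoothInd (standardParabolicGL F c) σ'),
        x ∈ vanishingOn (standardParabolicGL F c) σ' (cellLT (K := F) c σ) ∧
        y = x - whittakerTwist (Representation.smoothIndRep (standardParabolicGL F c) σ') ψ u x} := by
  classical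
  haveI : T2Space F := (GaloisRepresentations.IsNonarchimedeanLocalField.isLocalField F).toT2Space
  -- notation: `w = P_σ`
  obtain ⟨w, hw⟩ : ∃ w : GL (Fin n) F, w = permGL σ := ⟨_, rfl⟩
  -- a non-trivial value of `ψ` and the elementary unipotent `r₀ = u_{i,i+1}(x₀)`
  obtain ⟨x₀, hx₀⟩ : ∃ x₀ : F, ψ x₀ ≠ 1 := by
    by_contra h
    simp only [not_exists, not_not] at h
    exact hψ.2 (AddChar.ext _ _ fun x => by rw [h x, AddChar.zero_apply])
  have hx₀' : ((ψ x₀ : Circle) : ℂ) ≠ 1 := fun h => hx₀ (Circle.ext (by simpa using h))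
  obtain ⟨k, hk⟩ : ∃ k : Fin n, (k : ℕ) = (i : ℕ) + 1 := ⟨⟨(i : ℕ) + 1, hi⟩, rfl⟩
  have hik : (i : ℕ) + 1 = k := hk.symm
  have hik' : i ≠ k := fun h => by rw [h] at hik; omega
  have hasc' : c (σ.symm i) < c (σ.symm k) := by
    have : k = ⟨(i : ℕ) + 1, hi⟩ := Fin.ext hk
    rw [this]
    exact hasc
  set r₀ : ↥(upperUnitriangular (Fin n) F) := ⟨transvectionGL i k hik' x₀,
    transvectionGL_mem_upperUnitriangular (Fin.lt_def.2 (by omega)) x₀⟩ with hr₀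
  have hθr₀ : ((whittakerChar (n := n) ψ r₀ : ℂˣ) : ℂ) = ψ x₀ := whittakerChar_transvectionGL ψ hik x₀
  have hr₀N : w * (r₀ : GL (Fin n) F) * w⁻¹ ∈ unipotentRadicalGL F c := by
    rw [hw]
    exact permGL_mul_transvectionGL_mul_inv_mem_unipotentRadicalGL c σ hik' hasc' x₀
  have hr₀P : w * (r₀ : GL (Fin n) F) * w⁻¹ ∈ standardParabolicGL F c := unipotentRadicalGL_le F c hr₀N
  -- the compact `C ⊆ U` controlling the support of `u ↦ f (P_σ u)`
  have hPinv : ∀ p ∈ standardParabolicGL F c, ∀ g, f.toFun (p * g) ≠ 0 ↔ f.toFun g ≠ 0 := by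
    intro p hp g
    rw [show p * g = ((⟨p, hp⟩ : ↥(standardParabolicGL F c)) : GL (Fin n) F) * g from rfl,
      Representation.SmoothInd.toFun_subgroup_mul, not_iff_not]
    constructor
    · intro h
      have := congrArg (σ' (⟨p, hp⟩ : ↥(standardParabolicGL F c))⁻¹) h
      rwa [map_zero, ← Module.End.mul_apply, ← map_mul, inv_mul_cancel, map_one,
        Module.End.one_apply] at this
    · intro h
      rw [h, map_zero]
  obtain ⟨C, hC, hCsupp⟩ := exists_isCompact_support_of_eq_zero_on_cellLT (F := F) c hc σ f.toFun
    (Representation.SmoothInd.isClosed_setOf_toFun_ne_zero f) hPinv hf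
  -- a compact open subgroup `U_j ⊇ C ∪ {r₀}` of `U`
  obtain ⟨Uj, -, hUjc, hUjsub⟩ := isLimitOfCompactOpen_upperUnitriangular (F := F) (n := n) _
    (hC.union (Set.finite_singleton r₀).isCompact)
  have hCUj : C ⊆ Uj := fun v hv => hUjsub (Or.inl hv)
  have hr₀Uj : r₀ ∈ Uj := hUjsub (Or.inr rfl)
  -- the open subgroup `T = Stab(f) ∩ Ker ψ_U` and a transversal `R` of `U_j / (U_j ∩ T)`
  have hρθsmooth : (whittakerTwist (Representation.smoothIndRep (standardParabolicGL F c) σ') ψ).IsSmooth :=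
    (Representation.isSmooth_smoothInd (standardParabolicGL F c) σ').charTwist
      (upperUnitriangular (Fin n) F) (isOpen_ker_whittakerChar hψ.1)
  obtain ⟨T, hT⟩ : ∃ T : Subgroup ↥(upperUnitriangular (Fin n) F),
      T = (whittakerTwist (Representation.smoothIndRep (standardParabolicGL F c) σ') ψ).stabilizerSubgroup f ⊓
        (whittakerChar (n := n) ψ).ker := ⟨_, rfl⟩
  have hTo : IsOpen (T : Set ↥(upperUnitriangular (Fin n) F)) := by
    rw [hT]
    exact (hρθsmooth f).inter (isOpen_ker_whittakerChar hψ.1)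
  obtain ⟨R, hR⟩ := exists_isLeftTransversal (B := Uj) hUjc hTo
  have hcard : (R.card : ℂ) ≠ 0 := Nat.cast_ne_zero.2 (Finset.card_ne_zero.2 hR.nonempty)
  -- invariance of `f` under `U_j ∩ T`, and `ψ_U = 1` there
  have hTf : ∀ s ∈ Uj ⊓ T, Representation.smoothIndRep (standardParabolicGL F c) σ' (s : GL (Fin n) F) f = f ∧
      ((whittakerChar (n := n) ψ s : ℂˣ) : ℂ) = 1 := by
    intro s hs
    have hsT : s ∈ (whittakerTwist (Representation.smoothIndRep (standardParabolicGL F c) σ') ψ).stabilizerSubgroup f ⊓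
        (whittakerChar (n := n) ψ).ker := by
      have := (Subgroup.mem_inf.1 hs).2
      rwa [hT] at this
    obtain ⟨hs1, hs2⟩ := Subgroup.mem_inf.1 hsT
    have hs2' : ((whittakerChar (n := n) ψ s : ℂˣ) : ℂ) = 1 := by
      rw [MonoidHom.mem_ker] at hs2
      rw [hs2, Units.val_one]
    refine ⟨?_, hs2'⟩
    have hs1' := (Representation.mem_stabilizerSubgroup _ _ _).1 hs1
    rw [whittakerTwist_apply, ← coe_whittakerChar, hs2', inv_one, one_smul] at hs1'
    exact hs1'
  -- the candidate `f'`
  obtain ⟨f', hf'⟩ : ∃ f' : Representation.SmoothInd (standardParabolicGL F c) σ',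
      f' = (R.card : ℂ)⁻¹ • ∑ r ∈ R, whittakerTwist (Representation.smoothIndRep (standardParabolicGL F c) σ') ψ r f :=
    ⟨_, rfl⟩
  -- the auxiliary function `φ(y) = ψ_U(y)⁻¹ f (P_σ y)` on `U` and its two invariances
  obtain ⟨φ, hφ⟩ : ∃ φ : ↥(upperUnitriangular (Fin n) F) → W,
      φ = fun y => ((whittakerChar (n := n) ψ y : ℂˣ) : ℂ)⁻¹ • f.toFun (w * y) := ⟨_, rfl⟩
  have hφS : ∀ y ∈ Uj, ∀ s ∈ Uj ⊓ T, φ (y * s) = φ y := by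
    intro y _ s hs
    obtain ⟨hs1, hs2⟩ := hTf s hs
    have h1 : f.toFun (w * ((y * s : ↥(upperUnitriangular (Fin n) F)) : GL (Fin n) F)) = f.toFun (w * y) := by
      have := congrArg (fun g : Representation.SmoothInd (standardParabolicGL F c) σ' => g.toFun (w * y)) hs1
      simp only [Representation.toFun_smoothIndRep_apply] at this
      rw [Subgroup.coe_mul, ← mul_assoc]
      exact this
    simp only [hφ, map_mul, Units.val_mul, hs2, mul_one, h1]
  have hφr₀ : ∀ y, φ (r₀ * y) = ((ψ x₀ : Circle) : ℂ)⁻¹ • φ y := by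
    intro y
    have h1 : f.toFun (w * ((r₀ * y : ↥(upperUnitriangular (Fin n) F)) : GL (Fin n) F)) = f.toFun (w * y) := by
      have : w * ((r₀ * y : ↥(upperUnitriangular (Fin n) F)) : GL (Fin n) F) =
          ((⟨w * r₀ * w⁻¹, hr₀P⟩ : ↥(standardParabolicGL F c)) : GL (Fin n) F) * (w * y) := by
        rw [Subgroup.coe_mul]
        change w * ((r₀ : GL (Fin n) F) * y) = w * r₀ * w⁻¹ * (w * y)
        group
      rw [this, Representation.SmoothInd.toFun_subgroup_mul, hN _ hr₀N, Module.End.one_apply]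
    simp only [hφ, map_mul, Units.val_mul, hθr₀, mul_inv, mul_smul, h1]
  -- `∑_{r ∈ R} φ r = 0`
  have hsum0 : ∑ r ∈ R, φ r = 0 := by
    have h1 : ∑ r ∈ R, φ (r₀ * r) = ∑ r ∈ R, φ r := hR.sum_mul_left φ hφS hr₀Uj
    simp only [hφr₀, ← Finset.smul_sum] at h1
    have h2 : (1 - ((ψ x₀ : Circle) : ℂ)⁻¹) • ∑ r ∈ R, φ r = 0 := by
      rw [sub_smul, one_smul, h1, sub_self]
    rcases smul_eq_zero.1 h2 with h | h
    · exfalso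
      apply hx₀'
      have h' : ((ψ x₀ : Circle) : ℂ)⁻¹ = 1 := by
        rwa [sub_eq_zero, eq_comm] at h
      rw [← inv_inv ((ψ x₀ : Circle) : ℂ), h', inv_one]
    · exact h
  -- `S(u₀) = ∑_r ψ_U(r)⁻¹ f (P_σ u₀ r)` vanishes for every `u₀ ∈ U`
  have hS : ∀ u₀ : ↥(upperUnitriangular (Fin n) F), ∑ r ∈ R, ((whittakerChar (n := n) ψ r : ℂˣ) : ℂ)⁻¹ •
      f.toFun (w * ((u₀ * r : ↥(upperUnitriangular (Fin n) F)) : GL (Fin n) F)) = 0 := by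
    -- first for `u₁ ∈ U_j`, by re-indexing the transversal
    have hUj : ∀ u₁ ∈ Uj, ∑ r ∈ R, ((whittakerChar (n := n) ψ r : ℂˣ) : ℂ)⁻¹ •
        f.toFun (w * ((u₁ * r : ↥(upperUnitriangular (Fin n) F)) : GL (Fin n) F)) = 0 := by
      intro u₁ hu₁
      have h1 : ∀ r, ((whittakerChar (n := n) ψ r : ℂˣ) : ℂ)⁻¹ •
          f.toFun (w * ((u₁ * r : ↥(upperUnitriangular (Fin n) F)) : GL (Fin n) F)) =
          ((whittakerChar (n := n) ψ u₁ : ℂˣ) : ℂ) • φ (u₁ * r) := by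
        intro r
        simp only [hφ, map_mul, Units.val_mul, mul_inv, smul_smul]
        congr 1
        rw [← mul_assoc, mul_inv_cancel₀ (Units.ne_zero _), one_mul]
      simp only [h1, ← Finset.smul_sum, hR.sum_mul_left φ hφS hu₁, hsum0, smul_zero]
    intro u₀
    by_cases hex : ∃ r ∈ R, f.toFun (w * ((u₀ * r : ↥(upperUnitriangular (Fin n) F)) : GL (Fin n) F)) ≠ 0
    · obtain ⟨r₁, hr₁, hne⟩ := hex
      have hne' : f.toFun (permGL σ * ((u₀ * r₁ : ↥(upperUnitriangular (Fin n) F)) : GL (Fin n) F)) ≠ 0 := by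
        rwa [hw] at hne
      obtain ⟨v, hvC, ha⟩ := hCsupp (u₀ * r₁) hne'
      rw [← hw] at ha
      -- `u₀ = (P_σ⁻¹ a P_σ) u₁` with `a ∈ P`, `u₁ = v r₁⁻¹ ∈ U_j`
      have hu₁ : v * r₁⁻¹ ∈ Uj := Uj.mul_mem (hCUj hvC) (Uj.inv_mem (hR.mem_of_mem r₁ hr₁))
      have hkey : ∀ y : ↥(upperUnitriangular (Fin n) F),
          f.toFun (w * ((u₀ * y : ↥(upperUnitriangular (Fin n) F)) : GL (Fin n) F)) =
          σ' ⟨_, ha⟩ (f.toFun (w * (((v * r₁⁻¹) * y : ↥(upperUnitriangular (Fin n) F)) : GL (Fin n) F))) := by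
        intro y
        rw [← Representation.SmoothInd.toFun_subgroup_mul]
        congr 1
        simp only [Subgroup.coe_mul, Subgroup.coe_inv]
        group
      simp only [hkey, ← map_smul, ← map_sum, hUj _ hu₁, map_zero]
    · simp only [not_exists, not_and, not_not] at hex
      exact Finset.sum_eq_zero fun r hr => by rw [hex r hr, smul_zero]
  -- `f'` vanishes on the cell of `σ` and on `cellLT σ`
  have hf'cell : ∀ g ∈ parabolicDoubleCoset (K := F) c σ, f'.toFun g = 0 := by
    rintro g ⟨p, hp, u₀, hu₀, rfl⟩
    rw [hf', Representation.SmoothInd.toFun_smul, Pi.smul_apply,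
      Representation.SmoothInd.toFun_sum, smul_eq_zero]
    right
    have : ∀ r ∈ R, (whittakerTwist (Representation.smoothIndRep (standardParabolicGL F c) σ') ψ r f).toFun
        (p * permGL σ * u₀) =
        σ' ⟨p, hp⟩ (((whittakerChar (n := n) ψ r : ℂˣ) : ℂ)⁻¹ • f.toFun (w *
          (((⟨u₀, hu₀⟩ : ↥(upperUnitriangular (Fin n) F)) * r : ↥(upperUnitriangular (Fin n) F)) : GL (Fin n) F))) := by
      intro r _
      rw [toFun_whittakerTwist_smoothIndRep, ← coe_whittakerChar, map_smul,
        ← Representation.SmoothInd.toFun_subgroup_mul]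
      congr 2
      change p * permGL σ * u₀ * (r : GL (Fin n) F) = p * (w * (u₀ * (r : GL (Fin n) F)))
      rw [hw]
      group
    rw [Finset.sum_congr rfl this, ← map_sum, hS, map_zero]
  have hf'LT : f' ∈ vanishingOn (standardParabolicGL F c) σ' (cellLT (K := F) c σ) := by
    rw [hf']
    refine Submodule.smul_mem _ _ (Submodule.sum_mem _ fun r _ => ?_)
    exact whittakerTwist_apply_mem_vanishingOn c σ' ψ (fun g hg u => mul_mem_cellsBelow c hg u) r hf
  refine ⟨f', ?_, ?_⟩
  · -- `cellLE = cellLT ∪ cell`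
    intro g hg
    rw [cellLE_eq_cellLT_union] at hg
    rcases hg with hg | hg
    · exact hf'LT g hg
    · exact hf'cell g hg
  · -- `f - f' = |R|⁻¹ ∑_r (f - ρθ r f)`
    have hx : (R.card : ℂ)⁻¹ • f ∈ vanishingOn (standardParabolicGL F c) σ' (cellLT (K := F) c σ) :=
      Submodule.smul_mem _ _ hf
    have heq : f - f' = ∑ r ∈ R, ((R.card : ℂ)⁻¹ • f -
        whittakerTwist (Representation.smoothIndRep (standardParabolicGL F c) σ') ψ r ((R.card : ℂ)⁻¹ • f)) := by
      rw [Finset.sum_sub_distrib, Finset.sum_const, ← Nat.cast_smul_eq_nsmul ℂ, smul_smul,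
        mul_inv_cancel₀ hcard, one_smul, hf', Finset.smul_sum]
      congr 1
      exact Finset.sum_congr rfl fun r _ => (map_smul _ _ _).symm
    rw [heq]
    exact Submodule.sum_mem _ fun r _ => Submodule.subset_span ⟨r, _, hx, rfl⟩

end MainVanishing

end Literature.NumberTheory.Automorphic
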